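import Literature.Computability.QuantumComplexity.PeriodFindingFourier
import Mathlib.Analysis.SpecialFunctions.Trigonometric.Bounds
import Mathlib.Algebra.BigOperators.Field

/-!
# The polygon Fermi level is optimal, I: the cosecant-square sums `(S1)`, `(S2)`
# (T-M1D.48 Theorem B, Step 2)

HONEST FRAMING: first certified bounds; not a superconductivity verdict; every number certified
or labelled float.  (Venture `CertifiedManyBodySolver`, programme `hubbard-alg`, team M1 seat 4
— the doped-point STRUCTURE seat; design note `structure/design/BLINDNESS-SANDWICH.md` §3,
entry T-M1D.48 "THEOREM B (the polygon Fermi level is optimal at every closed shell)";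
companions in this directory: `FejerMajorant.lean` (Prop. B6, the outermost shells),
`RobinNodeLattice.lean` (T-M1D.45), `MidpointEulerMaclaurin.lean` (T-M1D.49), and part II
`CosecantMidpointCells.lean` (Steps 3–4: the midpoint rule for `csc²` and the `+1 conditions`).)

## What Theorem B says and what the two files prove

For the `n`-site ring at the closed shell `ν = m/n` (`n ≥ 4`, `2 ≤ m ≤ n − 2`) Theorem B states
that the polygon Fermi level `K_c = cos(mπ/n)` lies in the interior of the optimal-kink interval
`K_opt(m/n)`, equivalently that the Hermite interpolant of the hinge `(c − K_c)_+` on the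
saturation polygon majorises the hinge.  Its proof (T-M1D.48) has four steps: Step 0 reduces it
to the strict `+1 condition` (T-M1D.47 blocking); Step 1 writes the Hermite interpolant with the
trigonometric kernels `ℓ_j = F_n(· − x_j)²/n²`, `m_j = ℓ_j · sin(· − x_j)` on the regular `n`-gon
and evaluates `T(0)` (even shell `m = 2p`) and `T″(0)` (odd shell `m = 2p+1`); Steps 2–4 are
pure finite-trigonometric-sum facts.  Parts I–II prove Steps 2–4 for symbolic `n, p`; Steps 0–1
(the interpolation framework of T-M1D.47 and the kernel values `ℓ_j(0) = 1/(n² sin²(x_j/2))`,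
`ℓ_0″(0) = −(n²−1)/6`, `ℓ_j″(0) = ½csc²(x_j/2)`) stay on paper and are NOT formalised.

This file (Step 2):
* `sum_inv_sin_sq_midpoints`  **(S1)** `Σ_{j<n} 1/sin²((2j+1)π/(2n)) = n²` (all `n`);
* `sum_inv_sin_sq_vertices`   **(S2)** `Σ_{j=1}^{n−1} 1/sin²(jπ/n) = (n² − 1)/3` (`n ≥ 1`);
* the Dirichlet-type sums `two_sin_mul_sum_cos_odd` (`2 sin x Σ_{i<p} cos((2i+1)x) = sin 2px`)
  and `sin_mul_one_add_two_sum_cos_even` (`sin x (1 + 2Σ_{1≤i≤p} cos 2ix) = sin((2p+1)x)`),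
  with their divided forms at `x = π/n` (`sum_two_cos_odd_eq_div`,
  `one_add_sum_two_cos_even_eq_div`) — the `Σ_caps cos x_j`-type sums of Step 3/3′;
* the cap/non-cap splittings `cap_sum_even`, `cap_sum_odd` of (S1)/(S2) used in Step 3/3′
  (`S_out`, `S_out′` = the non-cap sums bounded in part II).

## Method (no product formula, no limit)

The design note derives (S1)/(S2) from `Σ_j csc²(x + jπ/n) = n² csc²(nx)` at `x = π/(2n)` and
`x → 0`.  Here both are obtained algebraically from the discrete Parseval identity on `ℤ/n`
(`Literature.Computability.QuantumComplexity.PeriodFinding.parseval_range`, with the characters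
`ch`, `sum_ch_mul` of that file — reused, not restated): for (S2) the DFT of `u ↦ u` satisfies
`(1 − z_t)·S(t) = −n` at `z_t = e^{2πi t/n} ≠ 1`, so `1/sin²(tπ/n) = 4|S(t)|²/n²`, and Parseval
plus `Σu`, `Σu²` give `(n² − 1)/3`; for (S1) the DFT of `u ↦ e^{iπu/n}` is the geometric sum
`G(t) = Σ_u z^u`, `z = e^{iπ(2t+1)/n}`, `z^n = −1`, so `G(t)(z − 1) = −2`, `|G(t)|² =
1/sin²((2t+1)π/(2n))`, and Parseval gives `n·n`.  `|e^{ix} − 1| = 2|sin(x/2)|` is Mathlib's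
`Complex.norm_exp_I_mul_ofReal_sub_one`.

Float cross-check (labelled float, not part of the certificate): every identity below was
checked numerically for `n ≤ 120` before formalisation (seat folder `py/sanity.py`).
-/

namespace Summit.Ventures.CertifiedManyBodySolver.Conjectures.CosecantSquareSums

open Complex Finset
open scoped Real
open Literature.Computability.QuantumComplexity.PeriodFinding (ch ch_zero norm_ch sum_ch_mul
  parseval_range)

/-! ## §1 The cosecant-square sum over the `n`-gon vertices: `(S2)` -/

/-- **(S2)** `Σ_{j=1}^{n−1} 1/sin²(jπ/n) = (n² − 1)/3` for every `n ≥ 1`. -/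
theorem sum_inv_sin_sq_vertices (n : ℕ) (hn : 1 ≤ n) :
    ∑ j ∈ Ico 1 n, 1 / Real.sin (j * π / n) ^ 2 = ((n : ℝ) ^ 2 - 1) / 3 := by
  have hnpos : 0 < n := by omega
  have hn0 : (n : ℂ) ≠ 0 := by exact_mod_cast hnpos.ne'
  have hnR : (n : ℝ) ≠ 0 := by exact_mod_cast hnpos.ne'
  have hnRpos : (0 : ℝ) < n := by exact_mod_cast hnpos
  -- power sums `Σ k` and `Σ k²`, and the arithmetico-geometric identity
  have hsum : ∀ m : ℕ, ∑ k ∈ range m, (k : ℝ) = (m : ℝ) * (m - 1) / 2 := by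
    intro m
    induction m with
    | zero => simp
    | succ m ih => rw [sum_range_succ, ih]; push_cast; ring
  have hsq : ∀ m : ℕ, ∑ k ∈ range m, (k : ℝ) ^ 2 = (m : ℝ) * (m - 1) * (2 * m - 1) / 6 := by
    intro m
    induction m with
    | zero => simp
    | succ m ih => rw [sum_range_succ, ih]; push_cast; ring
  have harith : ∀ (z : ℂ) (m : ℕ), (1 - z) * ∑ k ∈ range m, (k : ℂ) * z ^ k
      = (∑ k ∈ range m, z ^ k) - 1 - ((m : ℂ) - 1) * z ^ m := by
    intro z m
    induction m with
    | zero => simp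
    | succ m ih =>
      rw [sum_range_succ, sum_range_succ, mul_add, ih]
      push_cast
      ring
  -- the characters `z_t = e^{2πi t/n}` and their powers
  have hpow : ∀ t u : ℕ, ch n (u * t) = ch n t ^ u := by
    intro t u
    rw [ch, ch, ← Complex.exp_nat_mul]; congr 1; push_cast; ring
  have hzn : ∀ t : ℕ, ch n t ^ n = 1 := by
    intro t
    rw [ch, ← Complex.exp_nat_mul]
    have : (n : ℂ) * (2 * π * I * (((t : ℤ) : ℂ) / n)) = (t : ℕ) * (2 * π * I) := by
      push_cast; field_simp
    rw [this]; exact Complex.exp_nat_mul_two_pi_mul_I t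
  have hgeom : ∀ t : ℕ, 1 ≤ t → t < n → ∑ u ∈ range n, ch n t ^ u = 0 := by
    intro t ht1 ht2
    have h := sum_ch_mul hnpos (t : ℤ)
    rw [if_neg (by
      intro hd
      have := Int.le_of_dvd (by exact_mod_cast ht1) hd
      omega)] at h
    rw [← h]
    exact sum_congr rfl fun u _ => (hpow t u).symm
  -- the DFT of `u ↦ u`
  set S : ℕ → ℂ := fun t => ∑ u ∈ range n, (u : ℂ) * ch n (u * t) with hS
  -- (a) for `1 ≤ t < n`: `(1 − z_t)·S t = −n`
  have ha : ∀ t ∈ Ico 1 n, (1 - ch n t) * S t = -n := by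
    intro t ht
    rw [mem_Ico] at ht
    simp only [hS]
    simp_rw [hpow t]
    rw [harith, hgeom t ht.1 ht.2, hzn t]
    ring
  -- (b) hence `1/sin²(tπ/n) = 4·|S t|²/n²`  (`|1 − z_t|² = 4 sin²(tπ/n)`)
  have hb : ∀ t ∈ Ico 1 n,
      1 / Real.sin (t * π / n) ^ 2 = 4 * ‖S t‖ ^ 2 / (n : ℝ) ^ 2 := by
    intro t ht
    have h1 := congrArg (fun w => ‖w‖ ^ 2) (ha t ht)
    simp only [norm_mul, mul_pow, norm_neg] at h1
    have h2 : ‖1 - ch n t‖ ^ 2 = 4 * Real.sin (t * π / n) ^ 2 := by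
      rw [norm_sub_rev, ch, show 2 * π * I * (((t : ℤ) : ℂ) / n) = I * ((2 * π * t / n : ℝ) : ℂ) by
        push_cast; ring, Complex.norm_exp_I_mul_ofReal_sub_one, Real.norm_eq_abs, sq_abs,
        show (2 * π * (t : ℝ) / n / 2 : ℝ) = (t : ℝ) * π / n by ring]
      ring
    have h3 : ‖(n : ℂ)‖ ^ 2 = (n : ℝ) ^ 2 := by rw [Complex.norm_natCast]
    rw [h2, h3] at h1
    -- `h1 : 4 sin² · |S t|² = n²`
    rw [mem_Ico] at ht
    have hs : Real.sin (t * π / n) ^ 2 ≠ 0 := by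
      have ht1 : (1 : ℝ) ≤ t := by exact_mod_cast ht.1
      have ht2 : (t : ℝ) < n := by exact_mod_cast ht.2
      apply pow_ne_zero
      apply (Real.sin_pos_of_pos_of_lt_pi _ _).ne'
      · exact div_pos (mul_pos (by linarith) Real.pi_pos) hnRpos
      · rw [div_lt_iff₀ hnRpos]
        calc (t : ℝ) * π < n * π := mul_lt_mul_of_pos_right ht2 Real.pi_pos
          _ = π * n := mul_comm _ _
    rw [div_eq_div_iff hs (pow_ne_zero 2 hnR)]
    linear_combination (-1 : ℝ) * h1
  -- (c) Parseval for `a_u = u`, and the `t = 0` term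
  have hpar : ∑ t ∈ range n, ‖S t‖ ^ 2 = n * ∑ u ∈ range n, ‖(u : ℂ)‖ ^ 2 :=
    parseval_range hnpos (fun u => (u : ℂ))
  have hsqC : ∑ u ∈ range n, ‖(u : ℂ)‖ ^ 2 = (n : ℝ) * (n - 1) * (2 * n - 1) / 6 := by
    rw [← hsq n]
    refine sum_congr rfl fun u _ => ?_
    rw [Complex.norm_natCast]
  have hS0 : ‖S 0‖ ^ 2 = ((n : ℝ) * (n - 1) / 2) ^ 2 := by
    have e : S 0 = ((∑ u ∈ range n, (u : ℝ) : ℝ) : ℂ) := by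
      rw [Complex.ofReal_sum]
      simp only [hS]
      refine sum_congr rfl fun u _ => ?_
      simp
    rw [e, Complex.norm_real, Real.norm_eq_abs, sq_abs, hsum n]
  -- (d) assemble: split off `t = 0` from the Parseval sum
  have hsplit : ∑ t ∈ range n, ‖S t‖ ^ 2 = ‖S 0‖ ^ 2 + ∑ t ∈ Ico 1 n, ‖S t‖ ^ 2 :=
    Finset.sum_range_eq_add_Ico _ hnpos
  have hval : ∑ t ∈ Ico 1 n, ‖S t‖ ^ 2
      = n * ((n : ℝ) * (n - 1) * (2 * n - 1) / 6) - ((n : ℝ) * (n - 1) / 2) ^ 2 := by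
    rw [hsqC] at hpar
    rw [hS0] at hsplit
    linarith
  rw [sum_congr rfl hb, ← Finset.sum_div, ← Finset.mul_sum, hval]
  field_simp
  ring

/-! ## §2 The cosecant-square sum over the edge midpoints: `(S1)` -/

/-- **(S1)** `Σ_{j<n} 1/sin²((2j+1)π/(2n)) = n²` for every `n`. -/
theorem sum_inv_sin_sq_midpoints (n : ℕ) :
    ∑ j ∈ range n, 1 / Real.sin ((2 * j + 1) * π / (2 * n)) ^ 2 = (n : ℝ) ^ 2 := by
  rcases Nat.eq_zero_or_pos n with h0 | hn
  · subst h0; simp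
  have hn0 : (n : ℂ) ≠ 0 := by exact_mod_cast hn.ne'
  have hnRpos : (0 : ℝ) < n := by exact_mod_cast hn
  -- `z_t = e^{iπ(2t+1)/n} = ch (2n) (2t+1)`; `G t = Σ_u z_t^u = Σ_u a_u e^{2πi ut/n}`, `a_u = ch (2n) u`
  set G : ℕ → ℂ := fun t => ∑ u ∈ range n, ch (2 * n) u * ch n (u * t) with hG
  have hz : ∀ t u : ℕ, ch (2 * n) u * ch n (u * t) = ch (2 * n) (2 * t + 1) ^ u := by
    intro t u
    rw [ch, ch, ch, ← Complex.exp_add, ← Complex.exp_nat_mul]; congr 1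
    push_cast; field_simp; ring
  have hzn : ∀ t : ℕ, ch (2 * n) (2 * t + 1) ^ n = -1 := by
    intro t
    rw [ch, ← Complex.exp_nat_mul]
    have : (n : ℂ) * (2 * π * I * (((2 * (t : ℤ) + 1 : ℤ) : ℂ) / (2 * n : ℕ)))
        = (t : ℕ) * (2 * π * I) + π * I := by
      push_cast; field_simp
    rw [this, Complex.exp_add, Complex.exp_nat_mul_two_pi_mul_I, Complex.exp_pi_mul_I]; ring
  -- (a) `G t · (z_t − 1) = −2`
  have ha : ∀ t : ℕ, G t * (ch (2 * n) (2 * t + 1) - 1) = -2 := by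
    intro t
    simp only [hG]; simp_rw [hz t]
    rw [geom_sum_mul, hzn]; norm_num
  -- (b) `1/sin²((2t+1)π/(2n)) = |G t|²`
  have hb : ∀ t ∈ range n,
      1 / Real.sin ((2 * t + 1) * π / (2 * n)) ^ 2 = ‖G t‖ ^ 2 := by
    intro t ht
    rw [mem_range] at ht
    have h1 := congrArg (fun w => ‖w‖ ^ 2) (ha t)
    simp only [norm_mul, mul_pow, norm_neg] at h1
    have h2 : ‖ch (2 * n) (2 * t + 1) - 1‖ ^ 2 = 4 * Real.sin ((2 * t + 1) * π / (2 * n)) ^ 2 := by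
      rw [ch, show 2 * π * I * (((2 * (t : ℤ) + 1 : ℤ) : ℂ) / (2 * n : ℕ))
          = I * (((2 * t + 1) * π / n : ℝ) : ℂ) by push_cast; field_simp,
        Complex.norm_exp_I_mul_ofReal_sub_one, Real.norm_eq_abs, sq_abs,
        show ((2 * (t : ℝ) + 1) * π / n / 2 : ℝ) = (2 * (t : ℝ) + 1) * π / (2 * n) by ring]
      ring
    have h3 : ‖(2 : ℂ)‖ ^ 2 = 4 := by rw [Complex.norm_two]; norm_num
    rw [h2, h3] at h1
    have hs : Real.sin ((2 * t + 1) * π / (2 * n)) ^ 2 ≠ 0 := by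
      have ht' : (t : ℝ) + 1 ≤ n := by exact_mod_cast ht
      apply pow_ne_zero
      apply (Real.sin_pos_of_pos_of_lt_pi _ _).ne'
      · positivity
      · rw [div_lt_iff₀ (by positivity)]
        calc (2 * (t : ℝ) + 1) * π < (2 * n) * π :=
              mul_lt_mul_of_pos_right (by linarith) Real.pi_pos
          _ = π * (2 * n) := mul_comm _ _
    rw [div_eq_iff hs]
    linear_combination (-1 / 4 : ℝ) * h1
  rw [sum_congr rfl hb]
  have hpar : ∑ t ∈ range n, ‖G t‖ ^ 2 = n * ∑ u ∈ range n, ‖ch (2 * n) u‖ ^ 2 :=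
    parseval_range hn _
  rw [hpar]
  simp_rw [norm_ch]
  simp only [one_pow, sum_const, card_range, nsmul_eq_mul, mul_one]
  ring

/-! ## §3 The two Dirichlet-type sums of Step 3/3′ -/

/-- `2 sin x · Σ_{i<p} cos((2i+1)x) = sin(2px)`. -/
theorem two_sin_mul_sum_cos_odd (x : ℝ) (p : ℕ) :
    2 * Real.sin x * ∑ i ∈ range p, Real.cos ((2 * i + 1) * x) = Real.sin (2 * p * x) := by
  induction p with
  | zero => simp
  | succ p ih =>
    rw [sum_range_succ]
    push_cast
    have e1 : x - (2 * (p : ℝ) + 1) * x = -(2 * p * x) := by ring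
    have e2 : x + (2 * (p : ℝ) + 1) * x = 2 * ((p : ℝ) + 1) * x := by ring
    rw [mul_add, ih, Real.two_mul_sin_mul_cos, e1, e2, Real.sin_neg]
    ring

/-- `sin x · (1 + 2 Σ_{i<p} cos(2(i+1)x)) = sin((2p+1)x)`. -/
theorem sin_mul_one_add_two_sum_cos_even (x : ℝ) (p : ℕ) :
    Real.sin x * (1 + 2 * ∑ i ∈ range p, Real.cos (2 * (i + 1) * x))
      = Real.sin ((2 * p + 1) * x) := by
  induction p with
  | zero => simp
  | succ p ih =>
    rw [sum_range_succ]
    push_cast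
    have e0 : Real.sin x * (1 + 2 * (∑ i ∈ range p, Real.cos (2 * ((i : ℝ) + 1) * x)
          + Real.cos (2 * ((p : ℝ) + 1) * x)))
        = Real.sin x * (1 + 2 * ∑ i ∈ range p, Real.cos (2 * ((i : ℝ) + 1) * x))
          + 2 * Real.sin x * Real.cos (2 * ((p : ℝ) + 1) * x) := by ring
    have e1 : x - 2 * ((p : ℝ) + 1) * x = -((2 * p + 1) * x) := by ring
    have e2 : x + 2 * ((p : ℝ) + 1) * x = (2 * ((p : ℝ) + 1) + 1) * x := by ring
    rw [e0, ih, Real.two_mul_sin_mul_cos, e1, e2, Real.sin_neg]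
    ring

/-- At `x = π/n`, `n ≥ 2`: `Σ_{i<p} 2cos((2i+1)π/n) = sin(2pπ/n)/sin(π/n)`. -/
theorem sum_two_cos_odd_eq_div (n p : ℕ) (hn : 2 ≤ n) :
    ∑ i ∈ range p, 2 * Real.cos ((2 * i + 1) * (π / n))
      = Real.sin (2 * p * (π / n)) / Real.sin (π / n) := by
  have hnR : (0 : ℝ) < n := by exact_mod_cast (by omega : 0 < n)
  have hsin : 0 < Real.sin (π / n) := by
    apply Real.sin_pos_of_pos_of_lt_pi (by positivity)
    rw [div_lt_iff₀ hnR]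
    have : (2 : ℝ) ≤ n := by exact_mod_cast hn
    nlinarith [Real.pi_pos]
  rw [eq_div_iff hsin.ne', ← two_sin_mul_sum_cos_odd, ← Finset.mul_sum]
  ring

/-- At `x = π/n`, `n ≥ 2`: `1 + Σ_{i=1}^{p} 2cos(2iπ/n) = sin((2p+1)π/n)/sin(π/n)`. -/
theorem one_add_sum_two_cos_even_eq_div (n p : ℕ) (hn : 2 ≤ n) :
    1 + ∑ i ∈ range p, 2 * Real.cos (2 * (i + 1) * (π / n))
      = Real.sin ((2 * p + 1) * (π / n)) / Real.sin (π / n) := by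
  have hnR : (0 : ℝ) < n := by exact_mod_cast (by omega : 0 < n)
  have hsin : 0 < Real.sin (π / n) := by
    apply Real.sin_pos_of_pos_of_lt_pi (by positivity)
    rw [div_lt_iff₀ hnR]
    have : (2 : ℝ) ≤ n := by exact_mod_cast hn
    nlinarith [Real.pi_pos]
  rw [eq_div_iff hsin.ne', ← sin_mul_one_add_two_sum_cos_even, ← Finset.mul_sum]
  ring

/-! ## §4 Cap / non-cap splittings of `(S1)` and `(S2)` -/

/-- Cap complement of `(S1)` (shell `m = 2p`): the `2p` cap half-angles carry
`Σ_{j<p} csc²((2j+1)π/(2n)) + Σ_{n−p≤j<n} csc²((2j+1)π/(2n)) = n² − S_out`. -/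
theorem cap_sum_even (n p : ℕ) (hpn : 2 * p ≤ n) :
    ∑ j ∈ range p, 1 / Real.sin ((2 * j + 1) * π / (2 * n)) ^ 2
      + ∑ j ∈ Ico (n - p) n, 1 / Real.sin ((2 * j + 1) * π / (2 * n)) ^ 2
      = (n : ℝ) ^ 2 - ∑ j ∈ Ico p (n - p), 1 / Real.sin ((2 * j + 1) * π / (2 * n)) ^ 2 := by
  have h := sum_inv_sin_sq_midpoints n
  rw [Finset.range_eq_Ico] at h ⊢
  rw [← Finset.sum_Ico_consecutive _ (by omega : 0 ≤ p) (by omega : p ≤ n),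
    ← Finset.sum_Ico_consecutive _ (by omega : p ≤ n - p) (by omega : n - p ≤ n)] at h
  linarith

/-- Cap complement of `(S2)` (shell `m = 2p+1`): the `2p` non-zero cap half-angles carry
`Σ_{1≤j≤p} csc²(jπ/n) + Σ_{n−p≤j<n} csc²(jπ/n) = (n² − 1)/3 − S_out′`. -/
theorem cap_sum_odd (n p : ℕ) (hpn : 2 * p + 1 ≤ n) :
    ∑ j ∈ Ico 1 (p + 1), 1 / Real.sin (j * π / n) ^ 2
      + ∑ j ∈ Ico (n - p) n, 1 / Real.sin (j * π / n) ^ 2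
      = ((n : ℝ) ^ 2 - 1) / 3 - ∑ j ∈ Ico (p + 1) (n - p), 1 / Real.sin (j * π / n) ^ 2 := by
  have h := sum_inv_sin_sq_vertices n (by omega)
  rw [← Finset.sum_Ico_consecutive _ (by omega : 1 ≤ p + 1) (by omega : p + 1 ≤ n),
    ← Finset.sum_Ico_consecutive _ (by omega : p + 1 ≤ n - p) (by omega : n - p ≤ n)] at h
  linarith

end Summit.Ventures.CertifiedManyBodySolver.Conjectures.CosecantSquareSums
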